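import Summits.QuantumFields.YangMills.Theorems.UnitScaleTiltFluctuationComparisonRegPrSmallFieldRecursion
import Literature.MathematicalPhysics.QuantumFieldTheory.Balaban1983to89.T3RestrictedUnitDensity
import Literature.MathematicalPhysics.QuantumFieldTheory.Balaban1983to89.T3CruxEstimates
import HarnessLib

/-!
# S-PROFILE — THE ANCHORED PINNED ROW AT EVERY PROFILE ABOVE THE FLOORS FROM THE PURE-PIN ROW AT THE FLOOR PROFILE, WITH THE FLOOR RATE
# (the restricted density is monotone in the event; `hP`'s event at `(b₀, p₀) ⪰ (𝔟, 𝔭)` lies inside the pure pin «`a` large at height `j`» at `(𝔟, 𝔭)`)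

Cell `ym3-torus` (YM ladder rung R3 = continuum `SU(2)` Yang–Mills on the three-torus — a RUNG, NOT d = 4, NOT infinite volume, NOT a mass gap, NOT Clay).
Twin-width seat `ym-ust-19936-w8` (gen 11); `--supports stmt-QuantumFields-19936 --as helper`, count-neutral, definition-free, default heartbeats.
Crux `UnitScaleTilt.HistoryTailL` (stmt-QuantumFields-19936), skeleton of record `Cruxes/HistoryTailL/Lines/pinned_stability.lean` v2′; row R-19936-S = `stub_pinnedStep`, faces
✓`UV3PinnedStepOfAnchored` (★★OWNER RECORD 17at).  Bears on `ym3-torus-px8` g11's ‼ (F2) PROFILE COUPLING (LOCATE `LOCATE-PINNED41-RESTRICTION-px8g11.md`): the T3 (α) socket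
speaks ONE profile `(𝔠.b₀, 𝔠.p₀)`, whereas S-step quantifies over every profile `(b₀, p₀)` above floors `(b₁', p₁')`.

THE POINT.  What the (α) rows can deliver is the pinned (41) at ONE profile — naturally for the PURE PIN «`θBal_{𝔟,𝔭}(K − j) ≤ dist1(Ū^j(∂a))`» (no
finer-height conditioner: (41) sums over ALL histories through the pin anyway).  For a steeper profile `(b₀, p₀) ⪰ (𝔟, 𝔭)` the threshold only grows
(`θBal` is monotone in the profile on couplings `≤ 1`, [Balaban1985UV3] (7) p.257: `p(g) = b₀(1 + log g⁻¹)^{p₀}`), so `hP`'s event at `(b₀, p₀)` — «`a` large at height `j`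
AND every finer height small» — lies INSIDE the pure pin at `(𝔟, 𝔭)` (the conditioner is simply dropped; it points the wrong way for monotonicity and is not needed), and
the restricted density is MONOTONE in the event `dV`-a.e. (the tower is monotone in its start density, ✓`LogComparisonSmallFieldRecursion.towerDensity_mono_ae`).  Hence:
* §1 ★ `resDensity_mono_ae_of_subset` — `S ⊆ S'` ⇒ `ρ^S_k ≤ ρ^{S'}_k` a.e. (every level of the standing range).
* §2 ★ `pinEvent_subset_purePin_of_floor_le` — `0 ≤ 𝔟 ≤ b₀`, `𝔭 ≤ p₀`, `γ ≤ 1` ⇒ `hP`'s event at `(b₀, p₀)` ⊆ the pure pin at `(𝔟, 𝔭)` (same `(K, j, a)`).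
* §3 ★★★ `anchoredStep_of_purePin_floor` — per `(F, γ)` (`0 ≤ γ ≤ 1`), anchor `E`, depth `m`: from the PURE-PIN anchored row at the floor profile
  `∃ Cu c A, 0 < c ∧ ∀ K j ⟨guards⟩ a, ρ^{Pin_{𝔟𝔭}(K,j,a)}_K ≤ e^{−E K + Cu}·β_{K−j}^A·e^{−c·p_{𝔟,𝔭}(g_{K−j})²}` a.e. get, for EVERY `(b₀, p₀) ⪰ (𝔟, 𝔭)`, the anchored row
  for `hP`'s event at `(b₀, p₀)` WITH THE FLOOR RATE `e^{−c·p_{𝔟,𝔭}(g_{K−j})²}` — the shape of repair (R-a) «rate at the floors» (px8 g11); the registered v2′ rate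
  `p_{b₀,p₀}` is NOT produced (that is (F2): it is threshold-generic in print, (67)∕(70)–(71), but not in the one-profile socket).

HONEST SCOPE.  Bookkeeping (set inclusion + a.e. monotonicity); the pure-pin anchored (41) is R-19936-S's organ and stays DISPLAYED; nothing of `stub_pinnedStep`, `hP`,
`HistoryTailL` (19936) or the rung is proved here; no registered text is changed or proposed by this file.  Sorry-free, axioms standard.

References: T. Bałaban, *Ultraviolet stability of three-dimensional lattice pure gauge field theories*, Commun. Math. Phys. **102** (1985) 255–275
[Balaban1985UV3] ((2) p.256, (6)–(7) p.257, (41) p.266, (67), (70)–(71) p.273).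
-/

set_option autoImplicit false

noncomputable section

namespace Summit.QuantumFields.YangMills.Theorems.UV3PinnedStepProfileReduction

open MeasureTheory
open Literature.MathematicalPhysics.QuantumFieldTheory.Balaban1983to89
open Literature.MathematicalPhysics.QuantumFieldTheory.Balaban1983to89.T3ContinuumYM3Torus
open Literature.MathematicalPhysics.QuantumFieldTheory.Balaban1983to89.T3UnitLawDensityEML (ℰp emlDensity measurableE_ℰp)
open Literature.MathematicalPhysics.QuantumFieldTheory.Balaban1983to89.T3UnitScaleTilt (θBal histGood measurableSet_histGood)
open Literature.MathematicalPhysics.QuantumFieldTheory.Balaban1983to89.T3RestrictedUnitDensity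
  (resDensity towerDensity integrable_resDensity)
open Literature.MathematicalPhysics.QuantumFieldTheory.Balaban1983to89.Missing (boltzmann boltzmann_pos measurable_plaqHol)
open Summit.QuantumFields.YangMills.Theorems.LogComparisonSmallFieldRecursion (towerDensity_mono_ae)

variable (F : T3Family) (γ : ℝ) (K : ℕ)

/-! ## §1 The restricted density is monotone in the event -/

/-- ★ **`S ⊆ S'` ⇒ `ρ^S_k ≤ ρ^{S'}_k` `dV_k`-a.e.** at every level `k ≤ m + K` (`0 ≤ γ`, both events measurable): the start densities satisfy
`𝟙_S·e^{−β_K A} ≤ 𝟙_{S'}·e^{−β_K A}` pointwise and the Radon–Nikodym tower is monotone a.e. in its start (✓`towerDensity_mono_ae`). [cite: Balaban1985UV3, (2) p.256 and (6) p.257] -/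
theorem resDensity_mono_ae_of_subset {γ} (hγ : 0 ≤ γ) {S S' : Set (GaugeField (F.P K) 0 (Matrix.specialUnitaryGroup (Fin 2) ℂ))}
    (hS : MeasurableSet S) (hS' : MeasurableSet S') (hSS' : S ⊆ S') {k : ℕ} (hk : k ≤ F.m + K) :
    resDensity F γ K S k ≤ᵐ[fieldMeasure (F.P K) k (Matrix.specialUnitaryGroup (Fin 2) ℂ)] resDensity F γ K S' k := by
  have h0 : resDensity F γ K S 0 ≤ᵐ[fieldMeasure (F.P K) 0 (Matrix.specialUnitaryGroup (Fin 2) ℂ)] resDensity F γ K S' 0 :=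
    Filter.Eventually.of_forall fun U =>
      Set.indicator_le_indicator_of_subset hSS' (fun V => (boltzmann_pos (F.P K) _ V).le) U
  exact towerDensity_mono_ae F K (integrable_resDensity F K hS hγ (k := 0) (Nat.zero_le _))
    (integrable_resDensity F K hS' hγ (k := 0) (Nat.zero_le _)) h0 k hk

/-! ## §2 `hP`'s event at a profile above the floors lies inside the pure pin at the floor profile -/

/-- ★ **`hP`'s EVENT AT `(b₀, p₀)` ⊆ THE PURE PIN AT THE FLOORS `(𝔟, 𝔭)`** (same run `K`, height `j`, plaquette `a`): «`θBal_{b₀p₀}(K−j) ≤ dist1(Ū^j(∂a))` ∧ (finer heights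
small)» ⇒ «`θBal_{𝔟𝔭}(K−j) ≤ dist1(Ū^j(∂a))`» whenever `0 ≤ 𝔟 ≤ b₀`, `𝔭 ≤ p₀`, `γ ≤ 1` — the conditioner is dropped, the threshold lowered: Bałaban's
`θBal L γ b₀ p₀ i = g_i·b₀(1 + log g_i⁻¹)^{p₀}` is monotone in the profile on couplings `γ ≤ 1` (`g_i ≤ 1`, `1 + log g_i⁻¹ ≥ 1`; inlined, cf.
`LargeFieldMassRefinementTailProfileMono.θBal_mono_profile`). [cite: Balaban1985UV3, (7) p.257] -/
theorem pinEvent_subset_purePin_of_floor_le {γ 𝔟 𝔭 b₀ p₀ : ℝ} (hγ1 : γ ≤ 1) (h𝔟 : 0 ≤ 𝔟) (hbb : 𝔟 ≤ b₀) (hpp : 𝔭 ≤ p₀)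
    {j : ℕ} (a : Plaq (F.P K) j) :
    ({U : GaugeField (F.P K) 0 (Matrix.specialUnitaryGroup (Fin 2) ℂ) |
          θBal F.L γ b₀ p₀ (K - j) ≤ GaugeGroup.dist1 (GaugeField.plaqHol
            (Averaging.iter (fun i' => BlockAveraging.blockAvg (P := F.P K) (j := i') ℰp) j U) a)} ∩
        {U : GaugeField (F.P K) 0 (Matrix.specialUnitaryGroup (Fin 2) ℂ) | ∀ i, i < j →
          PlaqSmall (θBal F.L γ b₀ p₀ (K - i))
            (Averaging.iter (fun i' => BlockAveraging.blockAvg (P := F.P K) (j := i') ℰp) i U)}) ⊆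
      {U : GaugeField (F.P K) 0 (Matrix.specialUnitaryGroup (Fin 2) ℂ) |
        θBal F.L γ 𝔟 𝔭 (K - j) ≤ GaugeGroup.dist1 (GaugeField.plaqHol
          (Averaging.iter (fun i' => BlockAveraging.blockAvg (P := F.P K) (j := i') ℰp) j U) a)} := by
  intro U hU
  have hU1 : θBal F.L γ b₀ p₀ (K - j) ≤ GaugeGroup.dist1 (GaugeField.plaqHol
      (Averaging.iter (fun i' => BlockAveraging.blockAvg (P := F.P K) (j := i') ℰp) j U) a) := hU.1
  refine le_trans ?_ hU1
  -- `θBal` is monotone in the profile on couplings `γ ≤ 1` (`g ≤ 1`, `1 + log g⁻¹ ≥ 1`; cf. `LargeFieldMassRefinementTailProfileMono.θBal_mono_profile`)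
  unfold θBal B10.pFun
  set g : ℝ := Real.sqrt (γ * ((F.L : ℝ)⁻¹) ^ (K - j)) with hg
  have hL0 : (0 : ℝ) ≤ ((F.L : ℝ)⁻¹) := inv_nonneg.mpr (Nat.cast_nonneg F.L)
  have hx1 : γ * ((F.L : ℝ)⁻¹) ^ (K - j) ≤ 1 :=
    calc γ * ((F.L : ℝ)⁻¹) ^ (K - j) ≤ 1 * 1 :=
          mul_le_mul hγ1 (pow_le_one₀ hL0 (Nat.cast_inv_le_one F.L)) (pow_nonneg hL0 _) zero_le_one
      _ = 1 := one_mul 1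
  have hg0 : 0 ≤ g := Real.sqrt_nonneg _
  have hg1 : g ≤ 1 := (Real.sqrt_le_sqrt hx1).trans_eq Real.sqrt_one
  have hlog : 0 ≤ Real.log g⁻¹ := by
    rcases hg0.eq_or_lt with h | h
    · rw [← h, inv_zero, Real.log_zero]
    · exact Real.log_nonneg ((one_le_inv₀ h).mpr hg1)
  have hu : (1 : ℝ) ≤ 1 + Real.log g⁻¹ := by linarith
  have hu0 : (0 : ℝ) ≤ 1 + Real.log g⁻¹ := zero_le_one.trans hu
  refine mul_le_mul_of_nonneg_left ?_ hg0
  calc 𝔟 * (1 + Real.log g⁻¹) ^ 𝔭 ≤ b₀ * (1 + Real.log g⁻¹) ^ 𝔭 :=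
        mul_le_mul_of_nonneg_right hbb (Real.rpow_nonneg hu0 _)
    _ ≤ b₀ * (1 + Real.log g⁻¹) ^ p₀ :=
        mul_le_mul_of_nonneg_left (Real.rpow_le_rpow_of_exponent_le hu hpp) (h𝔟.trans hbb)

/-- `hP`'s event is measurable for `j ≤ K` (the skeleton's own lines: `dist1 ∘ plaqHol ∘ Ū^j` measurable, the conditioner is the `histGood` set of depth `K − j + 1`).
[cite: Balaban1985UV3, (7) p.257] -/
theorem measurableSet_pinEvent (b₀ p₀ : ℝ) {j : ℕ} (hjK : j ≤ K) (a : Plaq (F.P K) j) :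
    MeasurableSet
      ({U : GaugeField (F.P K) 0 (Matrix.specialUnitaryGroup (Fin 2) ℂ) |
          θBal F.L γ b₀ p₀ (K - j) ≤ GaugeGroup.dist1 (GaugeField.plaqHol
            (Averaging.iter (fun i' => BlockAveraging.blockAvg (P := F.P K) (j := i') ℰp) j U) a)} ∩
        {U : GaugeField (F.P K) 0 (Matrix.specialUnitaryGroup (Fin 2) ℂ) | ∀ i, i < j →
          PlaqSmall (θBal F.L γ b₀ p₀ (K - i))
            (Averaging.iter (fun i' => BlockAveraging.blockAvg (P := F.P K) (j := i') ℰp) i U)}) := by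
  have hiter : ∀ i : ℕ, Measurable (Averaging.iter (fun i' => BlockAveraging.blockAvg (P := F.P K) (j := i') ℰp) i) := fun i =>
    T4Continuum.measurable_iter _ (F.avgMeasurable_of_measurableE ℰp measurableE_ℰp K) i
  refine (measurableSet_le measurable_const
      (RegularGaugeGroup.measurable_dist1.comp ((measurable_plaqHol a).comp (hiter j)))).inter ?_
  have hset : {U : GaugeField (F.P K) 0 (Matrix.specialUnitaryGroup (Fin 2) ℂ) | ∀ i, i < j →
      PlaqSmall (θBal F.L γ b₀ p₀ (K - i))
        (Averaging.iter (fun i' => BlockAveraging.blockAvg (P := F.P K) (j := i') ℰp) i U)} =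
      histGood F ℰp (θBal F.L γ b₀ p₀) K (K - j + 1) := by
    ext U
    simp only [histGood, Set.mem_setOf_eq]
    exact ⟨fun h i hi => h i (by omega), fun h i hi => h i (by omega)⟩
  rw [hset]
  exact measurableSet_histGood F ℰp measurableE_ℰp _ K _

/-- The pure pin is measurable. [cite: Balaban1985UV3, (7) p.257] -/
theorem measurableSet_purePin (𝔟 𝔭 : ℝ) {j : ℕ} (a : Plaq (F.P K) j) :
    MeasurableSet
      {U : GaugeField (F.P K) 0 (Matrix.specialUnitaryGroup (Fin 2) ℂ) |
        θBal F.L γ 𝔟 𝔭 (K - j) ≤ GaugeGroup.dist1 (GaugeField.plaqHol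
          (Averaging.iter (fun i' => BlockAveraging.blockAvg (P := F.P K) (j := i') ℰp) j U) a)} := by
  have hiter : ∀ i : ℕ, Measurable (Averaging.iter (fun i' => BlockAveraging.blockAvg (P := F.P K) (j := i') ℰp) i) := fun i =>
    T4Continuum.measurable_iter _ (F.avgMeasurable_of_measurableE ℰp measurableE_ℰp K) i
  exact measurableSet_le measurable_const (RegularGaugeGroup.measurable_dist1.comp ((measurable_plaqHol a).comp (hiter j)))

/-! ## §3 The anchored row at every profile above the floors from the pure-pin row at the floor profile, floor rate -/

/-- ★★★ **THE ANCHORED PINNED ROW FOR `hP`'s EVENT AT EVERY PROFILE `(b₀, p₀) ⪰ (𝔟, 𝔭)` FROM THE PURE-PIN ANCHORED ROW AT `(𝔟, 𝔭)`, WITH THE FLOOR RATE.**  For one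
family and coupling `0 ≤ γ ≤ 1`, an anchor `E : ℕ → ℝ`, a depth `m`: IF `∃ Cu c A, 0 < c ∧ ∀ K j ⟨1 ≤ j, j+2 ≤ K, j + (K−1)∕m ≤ K⟩ a, ρ^{Pin_{𝔟𝔭}(K,j,a)}_K ≤ e^{−E K + Cu}·β_{K−j}^A·
e^{−c·p_{𝔟,𝔭}(g_{K−j})²}` a.e., THEN for every `b₀ ≥ 𝔟`, `p₀ ≥ 𝔭` the same constants bound `ρ^{E_{b₀p₀}(K,j,a)}_K` a.e. by the same right side (§2 ⊆, §1 monotone) — the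
rate stays at the FLOOR profile (repair shape (R-a); the registered v2′ rate `p_{b₀,p₀}` is not produced). [cite: Balaban1985UV3, (7) p.257, (41) p.266, (70)–(71) p.273] -/
theorem anchoredStep_of_purePin_floor {γ 𝔟 𝔭 : ℝ} (hγ : 0 ≤ γ) (hγ1 : γ ≤ 1) (h𝔟 : 0 ≤ 𝔟) (E : ℕ → ℝ) (m : ℕ)
    (hPin : ∃ (Cu c : ℝ) (A : ℕ), 0 < c ∧
      ∀ (K j : ℕ), 1 ≤ j → j + 2 ≤ K → j + (K - 1) / m ≤ K → ∀ (a : Plaq (F.P K) j),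
        ∀ᵐ V ∂(fieldMeasure (F.P K) K (Matrix.specialUnitaryGroup (Fin 2) ℂ)),
          resDensity F γ K
            {U : GaugeField (F.P K) 0 (Matrix.specialUnitaryGroup (Fin 2) ℂ) |
              θBal F.L γ 𝔟 𝔭 (K - j) ≤ GaugeGroup.dist1 (GaugeField.plaqHol
                (Averaging.iter (fun i' => BlockAveraging.blockAvg (P := F.P K) (j := i') ℰp) j U) a)}
            K V ≤
          Real.exp (-E K + Cu) *
            ((F.scheme ℰp γ).β (K - j) ^ A * Real.exp (-(c * B10.pFun 𝔟 𝔭 (Real.sqrt (γ * ((F.L : ℝ)⁻¹) ^ (K - j))) ^ 2))))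
    {b₀ p₀ : ℝ} (hbb : 𝔟 ≤ b₀) (hpp : 𝔭 ≤ p₀) :
    ∃ (Cu c : ℝ) (A : ℕ), 0 < c ∧
      ∀ (K j : ℕ), 1 ≤ j → j + 2 ≤ K → j + (K - 1) / m ≤ K → ∀ (a : Plaq (F.P K) j),
        ∀ᵐ V ∂(fieldMeasure (F.P K) K (Matrix.specialUnitaryGroup (Fin 2) ℂ)),
          resDensity F γ K
            ({U : GaugeField (F.P K) 0 (Matrix.specialUnitaryGroup (Fin 2) ℂ) |
                θBal F.L γ b₀ p₀ (K - j) ≤ GaugeGroup.dist1 (GaugeField.plaqHol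
                  (Averaging.iter (fun i' => BlockAveraging.blockAvg (P := F.P K) (j := i') ℰp) j U) a)} ∩
              {U : GaugeField (F.P K) 0 (Matrix.specialUnitaryGroup (Fin 2) ℂ) | ∀ i, i < j →
                PlaqSmall (θBal F.L γ b₀ p₀ (K - i))
                  (Averaging.iter (fun i' => BlockAveraging.blockAvg (P := F.P K) (j := i') ℰp) i U)})
            K V ≤
          Real.exp (-E K + Cu) *
            ((F.scheme ℰp γ).β (K - j) ^ A * Real.exp (-(c * B10.pFun 𝔟 𝔭 (Real.sqrt (γ * ((F.L : ℝ)⁻¹) ^ (K - j))) ^ 2))) := by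
  obtain ⟨Cu, c, A, hc, hpin⟩ := hPin
  refine ⟨Cu, c, A, hc, fun K j hj1 hjK hjm a => ?_⟩
  have hmono := resDensity_mono_ae_of_subset F K hγ (measurableSet_pinEvent F γ K b₀ p₀ (by omega) a)
    (measurableSet_purePin F γ K 𝔟 𝔭 a) (pinEvent_subset_purePin_of_floor_le F K hγ1 h𝔟 hbb hpp a) (k := K) (Nat.le_add_left K F.m)
  filter_upwards [hmono, hpin K j hj1 hjK hjm a] with V h1 h2
  exact h1.trans h2

end Summit.QuantumFields.YangMills.Theorems.UV3PinnedStepProfileReduction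

end
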